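import Summits.CriticalPhenomena.PercolationContinuityZ3.Theorems.PercNearOneGluingNoHeavyLowerTailCubicFourPointL1LeFive
import HarnessLib

/-!
# `NoHeavyLowerTail` (stmt-CriticalPhenomena-4575) — (L1) in the deletion–contraction calculus: transport along injective relabellings, and
# **(L1) for every edge system touching at most five vertices of an ARBITRARY vertex type**

Support file (prover seat `prim-bnk-1`, bounded-n kernel theorems; `--supports stmt-CriticalPhenomena-4575`).  No definitions, no named facts, no sorries,
no `native_decide` here (COMPUTATIONAL ancestry: `TerminalEdgeStep.l1_le_five`, p197144).  Companion of `…CubicFourPointL1LeFive` (p201139), which proved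
`CubicFourPointL1.l1W_nonneg_fin_le_five` on the vertex type `Fin n`, `n ≤ 5`.

prim-l12-p2's closure calculus (`…CubicFourPointL1Step` ff.) is stated over an arbitrary vertex type `V` with finite random / forced edge sets
`D, K ⊆ Sym2 V`.  To use the bounded-n kernel theorem as a BASE CASE there one needs invariance of the masses under injective relabellings:

* `R_image_iff` — reachability with open edges `S` and forced edges `K` is invariant under an injective vertex map `φ : V → W`
  (edges mapped by `Sym2.map φ`); the nontrivial direction lifts a path in the image graph step by step (every image edge has both endpoints in the
  range of `φ`);
* `PrW_image` — the finitary probability of an event is invariant when coordinates are relabelled injectively and the event is transported;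
* `massesW_image`, `l1W_image` — hence the 14 masses of `(a,b,c,y)` and (L1) itself are invariant;
* **`l1W_nonneg_of_card_le_five`** — for every vertex type `V`, every finite `T ⊆ V` with `|T| ≤ 5`, all edge sets `D, K` with endpoints in `T`,
  all weights `0 ≤ p ≤ 1` and all pairwise distinct `a, b, c, y ∈ T`:  `0 ≤ l1W D p K a b c y`  (pull back to `Fin |T|` along `T.equivFin` and apply
  `l1W_nonneg_fin_le_five`).
So (L1) holds on every system whose edges and marked points live on at most five vertices; with p2's moves (pendant `b/c/y`, edges `ab, ac, bc`,
cut-vertex face, forest peeling) it follows on every graph those moves strip down to such a core.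
[cite: Grimmett1999, §2.2 (product measure; relabelling invariance of Bernoulli bond percolation)]; [cite: GladkovZimin2024HK, §4 (one-edge decomposition)]
-/

noncomputable section

namespace Summit.CriticalPhenomena.PercolationContinuityZ3.Theorems

namespace CubicFourPointL1

open Finset SimpleGraph Literature.Probability.Percolation Literature.Probability.Percolation.DecisionTree CubicThreePointStep

variable {V W : Type*} [DecidableEq V] [DecidableEq W]

/-! ### Reachability under an injective relabelling -/

omit [DecidableEq V] in
/-- An edge of `E` maps to an edge of the image: adjacency is preserved. [folklore] -/
theorem fromEdgeSet_image_adj {φ : V → W} (hφ : Function.Injective φ) (E : Finset (Sym2 V)) {u v : V}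
    (h : (fromEdgeSet (↑E : Set (Sym2 V))).Adj u v) :
    (fromEdgeSet (↑(E.image (Sym2.map φ)) : Set (Sym2 W))).Adj (φ u) (φ v) := by
  rw [fromEdgeSet_adj, Finset.mem_coe] at h ⊢
  refine ⟨?_, hφ.ne h.2⟩
  have : s(φ u, φ v) = Sym2.map φ s(u, v) := rfl
  rw [this]
  exact Finset.mem_image_of_mem _ h.1

omit [DecidableEq V] in
/-- Path lifting: a vertex reachable from `φ x` in the image graph is the image of a vertex reachable from `x`. [folklore] -/
theorem reflTransGen_image_lift {φ : V → W} (hφ : Function.Injective φ) (E : Finset (Sym2 V)) (x : V) {w : W}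
    (h : Relation.ReflTransGen (fromEdgeSet (↑(E.image (Sym2.map φ)) : Set (Sym2 W))).Adj (φ x) w) :
    ∃ z : V, φ z = w ∧ (fromEdgeSet (↑E : Set (Sym2 V))).Reachable x z := by
  induction h with
  | refl => exact ⟨x, rfl, Reachable.refl _⟩
  | tail _ hbc ih =>
    obtain ⟨z, hz, hxz⟩ := ih
    rw [fromEdgeSet_adj, Finset.mem_coe, Finset.mem_image] at hbc
    obtain ⟨⟨e, he, hmap⟩, hne⟩ := hbc
    revert he hmap
    refine Sym2.ind (fun u v => ?_) e
    intro he hmap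
    have hmap' : s(φ u, φ v) = s(_, _) := hmap
    rw [Sym2.eq_iff] at hmap'
    rcases hmap' with ⟨hu, hv⟩ | ⟨hu, hv⟩
    · have hzu : z = u := hφ (hz.trans hu.symm)
      subst hzu
      refine ⟨v, hv, hxz.trans ⟨Walk.cons ?_ Walk.nil⟩⟩
      rw [fromEdgeSet_adj, Finset.mem_coe]
      exact ⟨he, fun h => hne (by rw [← hu, ← hv, h])⟩
    · have hzv : z = v := hφ (hz.trans hv.symm)
      subst hzv
      refine ⟨u, hu, hxz.trans ⟨Walk.cons ?_ Walk.nil⟩⟩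
      rw [fromEdgeSet_adj, Finset.mem_coe, Sym2.eq_swap]
      exact ⟨he, fun h => hne (by rw [← hu, ← hv, h])⟩

/-- **Reachability (open edges `S`, forced edges `K`) is invariant under an injective relabelling of the vertices.** [folklore] -/
theorem R_image_iff {φ : V → W} (hφ : Function.Injective φ) (K S : Finset (Sym2 V)) (x y : V) :
    R (K.image (Sym2.map φ)) (S.image (Sym2.map φ)) (φ x) (φ y) ↔ R K S x y := by
  unfold R
  rw [← Finset.image_union]
  constructor
  · intro h
    rw [reachable_iff_reflTransGen] at h
    obtain ⟨z, hz, hxz⟩ := reflTransGen_image_lift hφ (S ∪ K) x h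
    have : z = y := hφ hz
    subst this
    exact hxz
  · intro h
    exact h.map ⟨φ, fun hab => fromEdgeSet_image_adj hφ (S ∪ K) hab⟩

/-! ### Finitary probabilities under an injective relabelling of the coordinates -/

/-- The Bernoulli weight of a transported configuration. [folklore] -/
theorem wtW_image {φ : V → W} (hφ : Function.Injective φ) (D S : Finset (Sym2 V)) (p : Sym2 W → ℝ) :
    wtW (D.image (Sym2.map φ)) p (S.image (Sym2.map φ)) = wtW D (p ∘ Sym2.map φ) S := by
  have hinj : Function.Injective (Sym2.map φ) := Sym2.map.injective hφ
  unfold wtW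
  rw [Finset.prod_image (hinj.injOn.mono (Set.subset_univ _))]
  refine Finset.prod_congr rfl fun e _ => ?_
  simp only [hinj.mem_finset_image, Function.comp]

/-- **Transport of a finitary probability**: if the event `X'` on the image coordinates corresponds to `X` under `S ↦ S.image (Sym2.map φ)`
(for `S ⊆ D`), then `PrW (D.image) p X' = PrW D (p ∘ Sym2.map φ) X`. [folklore] -/
theorem PrW_image {φ : V → W} (hφ : Function.Injective φ) (D : Finset (Sym2 V)) (p : Sym2 W → ℝ)
    (X : Set (Finset (Sym2 V))) (X' : Set (Finset (Sym2 W))) (hX : ∀ S, S ⊆ D → (S.image (Sym2.map φ) ∈ X' ↔ S ∈ X)) :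
    PrW (D.image (Sym2.map φ)) p X' = PrW D (p ∘ Sym2.map φ) X := by
  classical
  have hinj : Function.Injective (Sym2.map φ) := Sym2.map.injective hφ
  unfold PrW
  rw [Finset.powerset_image, Finset.sum_image (Finset.image_injOn_powerset_of_injOn (hinj.injOn.mono (Set.subset_univ _)))]
  refine Finset.sum_congr rfl fun S hS => ?_
  rw [Finset.mem_powerset] at hS
  by_cases hSX : S ∈ X
  · rw [Set.indicator_of_mem hSX, Set.indicator_of_mem ((hX S hS).2 hSX), wtW_image hφ]
  · rw [Set.indicator_of_notMem hSX, Set.indicator_of_notMem (fun h => hSX ((hX S hS).1 h))]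

/-- **The 14 masses of `(a,b,c,y)` are invariant under an injective relabelling.** [folklore] -/
theorem massesW_image {φ : V → W} (hφ : Function.Injective φ) (D K : Finset (Sym2 V)) (p : Sym2 W → ℝ) (a b c y : V) :
    massesW (D.image (Sym2.map φ)) p (K.image (Sym2.map φ)) (φ a) (φ b) (φ c) (φ y) = massesW D (p ∘ Sym2.map φ) K a b c y := by
  have hR := R_image_iff hφ K
  simp only [massesW, HybMasses.mk.injEq]
  refine ⟨?_, ?_, ?_, ?_, ?_, ?_, ?_, ?_, ?_, ?_, ?_, ?_, ?_, ?_⟩ <;>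
    refine PrW_image hφ D p _ _ fun S _ => ?_ <;>
    simp only [Set.mem_inter_iff, mem_sep, mem_cellA, hR]

/-- **(L1) is invariant under an injective relabelling.** [folklore] -/
theorem l1W_image {φ : V → W} (hφ : Function.Injective φ) (D K : Finset (Sym2 V)) (p : Sym2 W → ℝ) (a b c y : V) :
    l1W (D.image (Sym2.map φ)) p (K.image (Sym2.map φ)) (φ a) (φ b) (φ c) (φ y) = l1W D (p ∘ Sym2.map φ) K a b c y := by
  unfold l1W
  rw [massesW_image hφ]

/-! ### (L1) for every system touching at most five vertices -/

omit [DecidableEq V] [DecidableEq W] in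
/-- An edge with both endpoints in the range of `φ` is the image of an edge. [folklore] -/
theorem sym2_mem_range_of_forall_mem {φ : V → W} (e : Sym2 W) (h : ∀ v ∈ e, v ∈ Set.range φ) : ∃ e₀ : Sym2 V, Sym2.map φ e₀ = e := by
  revert h
  refine Sym2.ind (fun u v => ?_) e
  intro h
  obtain ⟨u₀, hu₀⟩ := h u (Sym2.mem_mk_left u v)
  obtain ⟨v₀, hv₀⟩ := h v (Sym2.mem_mk_right u v)
  exact ⟨s(u₀, v₀), by rw [Sym2.map_mk, hu₀, hv₀]⟩

omit [DecidableEq V] in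
/-- A finite edge set with endpoints in the range of an injective `φ` is the image of a finite edge set. [folklore] -/
theorem exists_preimage_edges {φ : V → W} [Fintype V] (D : Finset (Sym2 W)) (hD : ∀ e ∈ D, ∀ v ∈ e, v ∈ Set.range φ) :
    ∃ D₀ : Finset (Sym2 V), D₀.image (Sym2.map φ) = D := by
  refine ⟨Finset.univ.filter fun e₀ => Sym2.map φ e₀ ∈ D, ?_⟩
  ext e
  simp only [Finset.mem_image, Finset.mem_filter, Finset.mem_univ, true_and]
  constructor
  · rintro ⟨e₀, he₀, rfl⟩
    exact he₀
  · intro he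
    obtain ⟨e₀, rfl⟩ := sym2_mem_range_of_forall_mem e (hD e he)
    exact ⟨e₀, he, rfl⟩

/-- **(L1) on every edge system touching at most five vertices**, arbitrary vertex type.  If `T` is a finite vertex set with `|T| ≤ 5` carrying
all endpoints of the random edges `D` and the forced edges `K` as well as the four pairwise distinct marked points `a, b, c, y`, then for all
weights `0 ≤ p ≤ 1`:  `0 ≤ l1W D p K a b c y`, i.e. `E1 + E2 ≥ β·P(b≁c)`.  (COMPUTATIONAL ancestry: `TerminalEdgeStep.l1_le_five`.) [folklore] -/
theorem l1W_nonneg_of_card_le_five (T : Finset V) (hT : T.card ≤ 5) (D K : Finset (Sym2 V)) (p : Sym2 V → ℝ)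
    (hp0 : ∀ e, 0 ≤ p e) (hp1 : ∀ e, p e ≤ 1)
    (hD : ∀ e ∈ D, ∀ v ∈ e, v ∈ T) (hK : ∀ e ∈ K, ∀ v ∈ e, v ∈ T)
    (a b c y : V) (ha : a ∈ T) (hb : b ∈ T) (hc : c ∈ T) (hy : y ∈ T)
    (hab : a ≠ b) (hac : a ≠ c) (hay : a ≠ y) (hbc : b ≠ c) (hby : b ≠ y) (hcy : c ≠ y) :
    0 ≤ l1W D p K a b c y := by
  -- the relabelling `g : Fin |T| → V` with range `T`
  let g : Fin T.card → V := fun i => ((T.equivFin.symm i : T) : V)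
  have hg : Function.Injective g := fun i j h => T.equivFin.symm.injective (Subtype.ext h)
  have hrange : ∀ v ∈ T, v ∈ Set.range g := fun v hv =>
    ⟨T.equivFin ⟨v, hv⟩, by simp only [g, Equiv.symm_apply_apply]⟩
  obtain ⟨D₀, hD₀⟩ := exists_preimage_edges (φ := g) D fun e he v hv => hrange v (hD e he v hv)
  obtain ⟨K₀, hK₀⟩ := exists_preimage_edges (φ := g) K fun e he v hv => hrange v (hK e he v hv)
  obtain ⟨a₀, ha₀⟩ := hrange a ha
  obtain ⟨b₀, hb₀⟩ := hrange b hb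
  obtain ⟨c₀, hc₀⟩ := hrange c hc
  obtain ⟨y₀, hy₀⟩ := hrange y hy
  rw [← hD₀, ← hK₀, ← ha₀, ← hb₀, ← hc₀, ← hy₀, l1W_image hg]
  refine l1W_nonneg_fin_le_five hT D₀ K₀ (p ∘ Sym2.map g) (fun e => hp0 _) (fun e => hp1 _) a₀ b₀ c₀ y₀
    ?_ ?_ ?_ ?_ ?_ ?_
  · intro h; exact hab (by rw [← ha₀, ← hb₀, h])
  · intro h; exact hac (by rw [← ha₀, ← hc₀, h])
  · intro h; exact hay (by rw [← ha₀, ← hy₀, h])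
  · intro h; exact hbc (by rw [← hb₀, ← hc₀, h])
  · intro h; exact hby (by rw [← hb₀, ← hy₀, h])
  · intro h; exact hcy (by rw [← hc₀, ← hy₀, h])

end CubicFourPointL1

end Summit.CriticalPhenomena.PercolationContinuityZ3.Theorems
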